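import Summits.HodgeConjecture.HodgeConjecture.Theses.BoundaryReadout
import Summits.HodgeConjecture.HodgeConjecture.Theorems.BoundaryAbsoluteness.Negative.HCSafety
import Summits.HodgeConjecture.HodgeConjecture.Theorems.BoundaryReadoutBoundarySupplyConstantFamily
import Summits.HodgeConjecture.HodgeConjecture.Theorems.BoundaryReadoutAbsoluteReductionStubAbsoluteOfIso
import Literature.AlgebraicGeometry.HodgeTheory.ConjugationChartExistence
import Literature.AlgebraicGeometry.HodgeTheory.RationallyNormalisedDeRhamFamily
import Literature.AlgebraicGeometry.HodgeTheory.ComplexConjugationHolds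
import Literature.AlgebraicGeometry.Motives.BaseChangeProofs
import Literature.AlgebraicGeometry.Motives.CyclesBaseChange
import Literature.AlgebraicGeometry.Motives.VarietiesUnitProofs
import Summits.HodgeConjecture.HodgeConjecture.Theorems.PadicSemiregularLiftHodgeBeyondAnchorsProductDescent
import Summits.HodgeConjecture.HodgeConjecture.Theorems.BoundaryReadoutBoundaryAbsolutenessStubRationalDescent
import Summits.HodgeConjecture.HodgeConjecture.Theorems.BoundaryReadoutBoundaryAbsolutenessStubTypeDescent
import Summits.HodgeConjecture.HodgeConjecture.Theorems.BoundaryReadoutBoundaryAbsolutenessStubVanishingPropagation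

/-!
# Disproof of `BoundaryAbsoluteness` (stmt-HodgeConjecture-15913) — findings

WORK FILE of the standing crux disprover (refuter-cdisprove-stmt-HodgeConjecture-15913-0; cycle 1,
2026-08-17; route `BoundaryReadout`, line picked by the lead: `typewise_readout`). Everything below
is kernel-checked (rc 0, NO `sorry`, axioms `propext/Classical.choice/Quot.sound`); the landable
part is proposed as `Theorems/BoundaryAbsoluteness/Negative/LoadBearing.lean` (p167879).

## Verdict: NO KILL — and none is possible short of `¬HC`

1. **HC-safe** (landed before this seat, `Negative/HCSafety`, p160716): Charles–Schnell Conj. 11.2.17 on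
   the tree's carriers implies the crux WITHOUT using any boundary hypothesis; so an unconditional
   `¬ BoundaryAbsoluteness` would refute 11.2.17, hence (granting "cycle classes are absolute Hodge")
   the summit. The route header's kill criterion (i) "a ℚ-structure leak off `ker N`" cannot bite the
   STATEMENT, only a proof.
2. **Mathematically a theorem** (paper check, agreeing with the idea card `boundary-kernel-factorisation`
   and with the lead's line): for `σ ∈ Aut ℂ` put `η := (2πi/σ(2πi))^{-p} ξ^σ` on `𝒳^σ`; `η` is rational
   on the conjugate pieces; `K := ker(H^{2p}(𝒳^σ) → ⊕ H^{2p}(Y_i^σ))` is defined over `ℚ`, so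
   `η ∈ H_ℚ + K_ℂ`; and `K` dies on every smooth fibre: Hodge III Cor. 8.2.8 (`X_o ⊂ 𝒳` closed in a
   smooth complete variety, `∐ Y_i → X_o` proper surjective from smooth complete: same kernel) + tube
   retraction + flat sections over the connected smooth locus. No limit MHS, no `sp`, no
   semistability. In the tree: stubs `stub_rationalDescent` (p166041), `stub_typeDescent` (p165961),
   `stub_vanishingPropagation` (p166658) of the line are LANDED; open: `stub_conjugate_exists`,
   `stub_conjugateNaturality` (closed modulo the named fact `chartConjugation_canonical`),
   `stub_conjugateFibre`, `stub_smoothFibreLocus` — each checked on paper below, all true.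
3. **No instantiable counter-configuration exists even formally.** `hf` forces `X_o ≠ ∅`, so `ι ≠ ∅`
   and `habs` must be PROVED for some piece; the only smooth projective scheme on which the tree proves
   an absolute Hodge class today is the point (`isAbsoluteHodgeClass_unit`, degree `2p ≥ 2`); pieces =
   points force `dim X_o = 0`, `N = 1`, `f` finite, and then a fibre `X_t` is smooth projective
   (geometrically irreducible!) only if `deg f = 1`, where the conclusion is again the point case —
   TRUE. Junk pieces (`Spec K` at generic points, infinite disjoint unions of points) are excluded by
   `IsSmoothProjective (m i) (Y i)` / `Finite ι` / σ-compactness of Hodge-model carriers.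

## (a) Load-bearing analysis — one `Without` statement per hypothesis (this file, §§ below)

| hypothesis deleted | status of the weakened crux | theorem |
|---|---|---|
| `hcov` (pieces cover `X_o`) | ⟺ Conj. 11.2.17 | `withoutCover_iff_hodgeClassesAbsolute` |
| `habs` (AH on the pieces) | ⟺ Conj. 11.2.17 | `withoutPieceAbsoluteness_iff_hodgeClassesAbsolute` |
| `hf` (f surjective) | ⟺ Conj. 11.2.17 (constant map, empty `X_o`) | `withoutSurjective_iff_hodgeClassesAbsolute` |
| `ht` (fibre smooth proj. of dim `n`) | **FALSE** (point family, `n := 1`) | `boundaryAbsoluteness_false_without_fibreHyp` |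
| `hξr` AND `hξh` (ξ rational of type (p,p)) | still TRUE: the line's 4 open stubs + 3 landed ones prove the crux for ANY complex `ξ` (rationality and type of `ξ|_{X_t}` descend from the pieces by `stub_rationalDescent`/`stub_typeDescent` along the σ-free kernel inclusion `stub_vanishingPropagation` + 5B) | `withoutRationalType_of_openStubs` (§ (a′)) — NOT load-bearing |
| `hY` (pieces smooth projective) | ill-typed weakening (`IsAbsoluteHodgeClass` of a non-proper piece quantifies over Hodge models that need the Hodge decomposition); Hodge III 8.2.8 needs COMPLETE smooth pieces — affine pieces break Claim 2 | informal |
| `hC` (base a smooth projective curve) | possibly unnecessary (any base: image of `𝒳` is irreducible; connectedness of the smooth locus is what is used) | informal |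
| `h𝒳` (total space smooth projective) | load-bearing for the MECHANISM (purity of `H^{2p}(𝒳)` is what kills `K` on `X_o`); weakened statement is junk-typed (`IsOfHodgeType N 𝒳`) | informal |

So the three BOUNDARY hypotheses `hf`, `hcov`, `habs` are each load-bearing exactly to the extent
that Conj. 11.2.17 is open (no `_false_without_` can be landed for them short of `¬HC`), the
conclusion's `ht` is load-bearing outright (typing), and `hξr`, `hξh` are NOT load-bearing.

## (b) Tightness / (c) strengthenings

* `S⁺⁺ = GlobalAbsoluteness` (conclude AH of `ξ` on `𝒳`): ≥ Conj. 11.2.17 (product families), not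
  refutable; correctly not claimed (census `CensusSignatures.lean`).
* Strengthening "drop `hξr`, `hξh`" (any complex class AH on the pieces ⟹ AH on smooth fibres): TRUE,
  follows from the line's stubs (table) — the planner may state the engine for complex `ξ`.
* Strengthening "drop geometric irreducibility of `X_t`" (smooth projective possibly disconnected
  fibres): plausible (AH is componentwise); "drop smoothness of `X_t`": junk-typed.
* Weakening `hcov` to "jointly dominant": free (projective pieces with dense image are surjective).

## -- Targets
None served (payload `targets = []`, `stuck_stubs = []`).

## -- Line `typewise_readout` (lead prover-line-stmt-HodgeConjecture-15913-0; skeleton v3, 7 stubs)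

* Joint sufficiency: `BoundaryAbsoluteness_of_stubs` kernel-checked by the lead — nothing smuggled.
* `stub_rationalDescent` / `stub_typeDescent` / `stub_vanishingPropagation`: LANDED. Paper check of
  5C incl. degenerate cases: `W` arbitrary open of smoothness (cofinite in the irreducible curve, so
  `W(ℂ)` is connected and meets every punctured disc at `o`); disconnected smooth fibres over `W`
  (Stein factorisation `E × C' → C' → C`): still true (the pieces must cover both components);
  `k = 0`: true (`Y_i(ℂ) ≠ ∅`). Fine.
* `stub_smoothFibreLocus` (open): TRUE — `W := C ∖ f(𝒳 ∖ sm(f))`; a smooth projective fibre `X_t`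
  forces `f` flat (integral `𝒳` ↠ Dedekind `C`) and smooth along `X_t` (EGA IV 17.5.1), so
  `t.pt ∈ W`; one relative dimension `N - 1` since `f⁻¹W` is irreducible. Degenerate `N = 1` (finite
  `f` of degree `d`): a fibre is `IsSmoothProjective 0` iff it is ONE REDUCED point iff `t` is not a
  branch value and has one preimage, which forces `d = 1`; for `d ≥ 2` no `t` qualifies,
  `W := C ∖ (branch locus)` is an open of smoothness and the clause on `t` is vacuous. No
  counter-instance.
* `stub_conjugateFibre` (open): TRUE bookkeeping — (i) `(X_t)^σ ≅ (𝒳^σ)_{t^σ}` (base change is a right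
  adjoint, `t^σ := (Spec ℂ)^σ ≅ Spec ℂ ≫ t^σ`); (ii) `Y_i^σ = Y_i ×_X X^σ` is cartesian, points of fibre
  products with prescribed images exist (`Scheme.Pullback.exists_preimage_pullback`).
* `stub_conjugate_exists` (open; = Jouanolou + GAGA + de Rham + Grothendieck): true in print; in the
  tree the affine case is now unconditional (`nonempty_conjugationChart_of_isAffine`), the projective
  case is the named fact `jouanolou_cohomologyChart`.
* `stub_conjugateNaturality` (closed modulo `Literature…ConjugationChartUniqueness.chartConjugation_canonical`):
  RISK AUDIT of clause (iii) of that fact ("EVERY natural, degree-`k` rationally normalised de Rham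
  family computes the canonical conjugation"). It needs: a natural (for `C^∞` maps of `E`-manifolds)
  automorphism `ψ` of `Hᵏ(–; ℂ)` that is a rational scalar on tori is the SAME rational scalar on
  `Hᵏ` of the analytification of every smooth affine `m`-fold (`m = dim E`). Sketch why this holds
  (not in print as such; the fact's Conner–Floyd citation covers only spherical classes): a Stein
  `m`-fold has the homotopy type of an `m`-complex, so `x ∈ Hᵏ(Y^an; ℤ)` is pulled back from the
  `m`-skeleton `L` of `K(ℤ,k)`; for `k < m`, `Hᵏ(L; ℚ) = ℚ` so `ψ_L` is a scalar, pinned to the torus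
  scalar through `(ℂ^*)^k × ℂ^{m-k}` (an `E`-manifold ≃ `T^k` mapping to `L` and receiving the class
  `dx₁∧…∧dx_k` from a torus); `L` is realised up to homotopy by an OPEN SUBSET OF `ℂᵐ` (Wall
  embedding up to homotopy of `m`-complexes in `ℝ^{2m}`, `m ≥ 3`; small `m` by hand); for `k = m`
  the `(m+1)`-skeleton of `K(ℤ,m)` is `Sᵐ ≃ ℂᵐ ∖ ℝ^{m-1}`. So no counterexample to (iii) is expected;
  but the fact is stronger than what stub 2 needs (it quantifies over ALL charts), and a cheaper,
  certainly-printed repair exists if ever needed: restrict `ConjugationChart.deRham` to families that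
  agree with integration on spheres `Sᵏ × ℝ^{2m-k} ⊂ ℂᵐ` (add that normalisation as a field).
  Either way the CRUX is unaffected (zero classes have only the zero conjugate in every chart, by
  `injective_map`; and by Claim 2 the only classes the pieces can certify unconditionally today are 0).

## Attack log (cycle 1)
probe rc 0 (W.lean); simp/aesop/exact? fail (rattack, re-confirmed by elaboration here); degenerate regimes N = 1 / p = 0 / 2p > 2(N-1)
/ ι = ∅ / k = 0 / t = o: true or excluded; junk pieces: excluded; exotic de Rham families: argued
scalar; compute: none possible (no decidable shadow). Negative lemmas landed: p167879 (4 theorems +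
helpers). Disproof.lean = this file.
-/

-- single-problem summit: Problem = Summit, so `HodgeConjecture` is duplicated in every name
set_option linter.dupNamespace false

noncomputable section

namespace Summit.HodgeConjecture.HodgeConjecture.Cruxes.BoundaryAbsoluteness.Disproof

open CategoryTheory CategoryTheory.Limits AlgebraicGeometry MonoidalCategory CartesianMonoidalCategory
open Literature.AlgebraicTopology.SingularHomology
open Literature.AlgebraicGeometry.Motives Literature.AlgebraicGeometry.HodgeTheory
open Summit.HodgeConjecture.HodgeConjecture.Theses.BoundaryReadout (BoundaryAbsoluteness)
open Summit.HodgeConjecture.HodgeConjecture.Theorems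

/-- Charles–Schnell Conj. 11.2.17 on the tree's carriers ("Hodge classes are absolute Hodge"),
spelled out exactly as in `Negative/HCSafety.boundaryAbsoluteness_of_hodgeIsAbsolute`.
[cite: CharlesSchnell2014Notes, §11.2.5 Conj. 11.2.17] -/
def HodgeClassesAbsolute : Prop :=
  ∀ ⦃n : ℕ⦄ ⦃X : SchemeOver ℂ⦄, IsSmoothProjective n X →
    ∀ (p : ℕ) (c : complexBetti X (2 * p)), IsRationalClass c → IsOfHodgeType n X (2 * p) p p c →
      IsAbsoluteHodgeClass n X p c

/-! ## (a) Load-bearing analysis, hypothesis `hcov` (the pieces COVER the fibre `X_o`) -/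

/-- The crux with the covering hypothesis `hcov` deleted (pieces need not cover `X_o`). -/
def BoundaryAbsolutenessWithoutCover : Prop :=
  ∀ (N p : ℕ) (𝒳 C : SchemeOver ℂ) (f : 𝒳 ⟶ C) (o : AlgPoints C ℂ),
    IsSmoothProjective N 𝒳 → IsSmoothProjective 1 C → Function.Surjective f.left.base →
    ∀ (ι : Type) [Finite ι] (m : ι → ℕ) (Y : ι → SchemeOver ℂ) (g : ∀ i, Y i ⟶ fiberOver f o),
      (∀ i, IsSmoothProjective (m i) (Y i)) →
      ∀ ξ : complexBetti 𝒳 (2 * p), IsRationalClass ξ → IsOfHodgeType N 𝒳 (2 * p) p p ξ →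
        (∀ i, IsAbsoluteHodgeClass (m i) (Y i) p
          (complexBetti.map (g i ≫ fiberι f o) (2 * p) ξ)) →
        ∀ (t : AlgPoints C ℂ) (n : ℕ), IsSmoothProjective n (fiberOver f t) →
          IsAbsoluteHodgeClass n (fiberOver f t) p (complexBetti.map (fiberι f t) (2 * p) ξ)

/-- **Without the covering hypothesis the crux IS Conj. 11.2.17.** (→) take the constant family
`X × ℙ¹ ⟶ ℙ¹` (`exists_constFamily`), NO pieces (`ι = PEmpty`), and transport absoluteness of
`ξ|_{X_t}` back to `X` along the slice isomorphism (`stub_absoluteOfIso`); (←) the conclusion is an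
instance of 11.2.17 (`IsRationalClass.pullback`, `IsOfHodgeType.map_of_isSmoothProjective`).
So `hcov` is load-bearing exactly to the extent that Conj. 11.2.17 is open: no `_false_without_hcov`
can be landed short of `¬` Conj. 11.2.17 (hence `¬HC`). [cite: CharlesSchnell2014Notes, §11.2.5 Conj. 11.2.17] -/
theorem withoutCover_iff_hodgeClassesAbsolute :
    BoundaryAbsolutenessWithoutCover ↔ HodgeClassesAbsolute := by
  constructor
  · intro h n X hX p c hc hpp
    obtain ⟨𝒳, C, f, t, ξ, e, h𝒳, hC, hf, hξr, hξh, ht, -, hslice⟩ := exists_constFamily hX p c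
    have key := h (n + 1) p 𝒳 C f t h𝒳 hC hf PEmpty (fun i => i.elim) (fun i => i.elim)
      (fun i => i.elim) (fun i => i.elim) ξ (hξr hc) (hξh hpp) (fun i => i.elim) t n ht
    have hback := stub_absoluteOfIso e ht hX p _ key
    have hs := hslice (𝟙 X)
    rw [Category.id_comp, complexBetti.map_id, complexBetti_map_comp_apply] at hs
    rw [hs] at hback
    exact hback
  · intro hHA N p 𝒳 C f o h𝒳 _ _ ι _ m Y g _ ξ hξr hξh _ t n ht
    exact hHA ht p _ (hξr.pullback (AlgPoints.mapContinuous (L := ℂ) (fiberι f t)))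
      (hξh.map_of_isSmoothProjective ht h𝒳 (fiberι f t))

/-! ## (a) Load-bearing analysis, hypothesis `habs` (the class is absolute Hodge ON THE PIECES) -/

/-- The crux with the absoluteness hypothesis `habs` on the pieces deleted. -/
def BoundaryAbsolutenessWithoutPieceAbsoluteness : Prop :=
  ∀ (N p : ℕ) (𝒳 C : SchemeOver ℂ) (f : 𝒳 ⟶ C) (o : AlgPoints C ℂ),
    IsSmoothProjective N 𝒳 → IsSmoothProjective 1 C → Function.Surjective f.left.base →
    ∀ (ι : Type) [Finite ι] (m : ι → ℕ) (Y : ι → SchemeOver ℂ) (g : ∀ i, Y i ⟶ fiberOver f o),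
      (∀ i, IsSmoothProjective (m i) (Y i)) →
      (∀ x : ↥(fiberOver f o).left, ∃ (i : ι) (y : ↥(Y i).left), (g i).left.base y = x) →
      ∀ ξ : complexBetti 𝒳 (2 * p), IsRationalClass ξ → IsOfHodgeType N 𝒳 (2 * p) p p ξ →
        ∀ (t : AlgPoints C ℂ) (n : ℕ), IsSmoothProjective n (fiberOver f t) →
          IsAbsoluteHodgeClass n (fiberOver f t) p (complexBetti.map (fiberι f t) (2 * p) ξ)

/-- **Without absoluteness on the pieces the crux IS Conj. 11.2.17** (constant family, one piece
`Y = X` glued in by the slice isomorphism, which covers `X_o = X_t`). [cite: CharlesSchnell2014Notes, §11.2.5 Conj. 11.2.17] -/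
theorem withoutPieceAbsoluteness_iff_hodgeClassesAbsolute :
    BoundaryAbsolutenessWithoutPieceAbsoluteness ↔ HodgeClassesAbsolute := by
  constructor
  · intro h n X hX p c hc hpp
    obtain ⟨𝒳, C, f, t, ξ, e, h𝒳, hC, hf, hξr, hξh, ht, hcov, hslice⟩ := exists_constFamily hX p c
    have key := h (n + 1) p 𝒳 C f t h𝒳 hC hf Unit (fun _ => n) (fun _ => X) (fun _ => e.hom)
      (fun _ => hX) (fun x => ?_) ξ (hξr hc) (hξh hpp) t n ht
    · have hback := stub_absoluteOfIso e ht hX p _ key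
      have hs := hslice (𝟙 X)
      rw [Category.id_comp, complexBetti.map_id, complexBetti_map_comp_apply] at hs
      rw [hs] at hback
      exact hback
    · obtain ⟨y, hy⟩ := hcov x
      exact ⟨(), y, hy⟩
  · intro hHA N p 𝒳 C f o h𝒳 _ _ ι _ m Y g _ _ ξ hξr hξh t n ht
    exact hHA ht p _ (hξr.pullback (AlgPoints.mapContinuous (L := ℂ) (fiberι f t)))
      (hξh.map_of_isSmoothProjective ht h𝒳 (fiberι f t))


/-! ## (a) Load-bearing analysis, conclusion clause `ht : IsSmoothProjective n (fiberOver f t)` -/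

/-- Identity conjugation charts on smooth affine schemes (copy of the tree theorem
`nonempty_conjugationChart_of_isAffine` of `Theorems/BoundaryReadoutBoundarySupplyZeroFloor`, whose
module is not yet built on the farm at the time of writing). [cite: CharlesSchnell2014Notes, §11.2.2 (11.2.1)–(11.2.3)] -/
theorem nonempty_conjugationChart_of_isAffine' (σ : ℂ ≃+* ℂ) (m : ℕ) (Y : SchemeOver ℂ)
    [IsAffine Y.left] [SmoothOfRelativeDimension m Y.hom] (k : ℕ) :
    Nonempty (ConjugationChart σ Y k) := by
  obtain ⟨A⟩ := nonempty_analyticModel_of_isAffine m Y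
  obtain ⟨A'⟩ := nonempty_analyticModel_of_isAffine m (conjugateVariety σ Y)
  obtain ⟨e, he, hr⟩ := exists_isRational_complexDeRhamIsoFamily_holds (Fin m → ℂ)
  have hid : ∀ a : complexBetti (conjugateVariety σ Y) k,
      complexBetti.map (conjHom σ (𝟙 Y)) k a = a := by
    intro a
    have h1 : conjHom σ (𝟙 Y) = 𝟙 (conjugateVariety σ Y) := (baseChangeHom σ.toRingHom).map_id Y
    rw [h1, complexBetti.map_id]
    rfl
  exact
    ⟨{ m := m, Y := Y, π := 𝟙 Y, E := Fin m → ℂ, an := A, anConj := A', deRham := e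
       deRham_isNatural := he, deRham_isRational := hr k
       injective_map := fun a b h => by rwa [hid, hid] at h }⟩

/-- Classes of positive even degree on the point are absolute Hodge (copy of the tree theorem
`isAbsoluteHodgeClass_unit`, same unbuilt module). [cite: CharlesSchnell2014Notes, Def. 11.2.3] -/
theorem isAbsoluteHodgeClass_unit' {p : ℕ} (hp : 1 ≤ p)
    (c : complexBetti (𝟙_ (SchemeOver ℂ)) (2 * p)) :
    IsAbsoluteHodgeClass 0 (𝟙_ (SchemeOver ℂ)) p c := by
  have hU : IsSmoothProjective 0 (𝟙_ (SchemeOver ℂ)) := isSmoothProjective_unit_holds ℂ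
  haveI := ComplexPoints.subsingleton_singularCohomology_of_lt hU ℂ (k := 2 * p) (by omega)
  obtain rfl : c = 0 := Subsingleton.elim _ _
  refine ⟨IsRationalClass.zero,
    isOfHodgeType_zero_of_isSmoothProjective nonempty_hodgeModel_holds hU _ _ _, fun σ => ⟨?_, ?_⟩⟩
  · haveI : IsAffine (𝟙_ (SchemeOver ℂ)).left := inferInstanceAs (IsAffine (Spec _))
    haveI : SmoothOfRelativeDimension 0 (𝟙_ (SchemeOver ℂ)).hom :=
      inferInstanceAs (SmoothOfRelativeDimension 0 (𝟙 _))
    obtain ⟨D⟩ := nonempty_conjugationChart_of_isAffine' σ 0 (𝟙_ (SchemeOver ℂ)) (2 * p)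
    exact ⟨0, isConjugateClass_zero D⟩
  · intro c' _
    have hUσ : IsSmoothProjective 0 (conjugateVariety σ (𝟙_ (SchemeOver ℂ))) :=
      IsSmoothProjective.conjugateVariety_holds σ hU
    haveI := ComplexPoints.subsingleton_singularCohomology_of_lt hUσ ℂ (k := 2 * p) (by omega)
    exact ⟨0, IsRationalClass.zero,
      isOfHodgeType_zero_of_isSmoothProjective nonempty_hodgeModel_holds hUσ _ _ _,
      Subsingleton.elim _ _⟩

/-- A scheme isomorphic (over `ℂ`) to the point has exactly one complex point. [folklore] -/
theorem subsingleton_complexPoints_of_iso_unit {Z : SchemeOver ℂ} (e : 𝟙_ (SchemeOver ℂ) ≅ Z) :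
    Subsingleton (ComplexPoints Z) ∧ Nonempty (ComplexPoints Z) := by
  refine ⟨⟨fun P Q => ?_⟩, ⟨toUnit _ ≫ e.hom⟩⟩
  have h : P ≫ e.inv = Q ≫ e.inv := toUnit_unique _ _
  simpa using congrArg (· ≫ e.hom) h

/-- **No Hodge model of positive dimension on a one-point scheme.** If `Z(ℂ)` is a single point, a
`HodgeModel n Z` with `1 ≤ n` cannot exist: its carrier is one point `m₀`, the chart at `m₀` has
the open singleton `{chart m₀}` as target inside the model space, a complex normed space of
dimension `n ≥ 1`, which has no isolated points. [cite: SerreGAGA1956, §2] -/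
theorem false_of_hodgeModel_of_subsingleton {Z : SchemeOver ℂ} [Subsingleton (ComplexPoints Z)]
    [hne : Nonempty (ComplexPoints Z)] {n : ℕ} (hn : 1 ≤ n) (A : HodgeModel n Z) : False := by
  have hφ := A.isAnalytification
  haveI : Subsingleton A.carrier := hφ.isHomeomorph.injective.subsingleton
  obtain ⟨P⟩ := hne
  obtain ⟨m₀, -⟩ := hφ.isHomeomorph.surjective P
  haveI : Nontrivial A.model :=
    Module.nontrivial_of_finrank_pos (R := ℂ) (by rw [hφ.finrank_eq]; omega)
  set c := chartAt A.model m₀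
  have htgt : c.target = {c m₀} := by
    ext y
    simp only [Set.mem_singleton_iff]
    constructor
    · intro hy
      have h1 : c (c.symm y) = y := c.right_inv hy
      rw [Subsingleton.elim (c.symm y) m₀] at h1
      exact h1.symm
    · rintro rfl
      exact c.map_source (mem_chart_source _ m₀)
  have hopen : IsOpen ({c m₀} : Set A.model) := htgt ▸ c.open_target
  exact (Module.punctured_nhds_neBot ℂ A.model (c m₀)).ne
    ((isOpen_singleton_iff_punctured_nhds (c m₀)).1 hopen)

/-- The crux with the fibre hypothesis `ht : IsSmoothProjective n (fiberOver f t)` of the conclusion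
deleted: absoluteness of `ξ|_{X_t}` is then claimed for EVERY `t` and EVERY dimension index `n`. -/
def BoundaryAbsolutenessWithoutFibreHyp : Prop :=
  ∀ (N p : ℕ) (𝒳 C : SchemeOver ℂ) (f : 𝒳 ⟶ C) (o : AlgPoints C ℂ),
    IsSmoothProjective N 𝒳 → IsSmoothProjective 1 C → Function.Surjective f.left.base →
    ∀ (ι : Type) [Finite ι] (m : ι → ℕ) (Y : ι → SchemeOver ℂ) (g : ∀ i, Y i ⟶ fiberOver f o),
      (∀ i, IsSmoothProjective (m i) (Y i)) →
      (∀ x : ↥(fiberOver f o).left, ∃ (i : ι) (y : ↥(Y i).left), (g i).left.base y = x) →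
      ∀ ξ : complexBetti 𝒳 (2 * p), IsRationalClass ξ → IsOfHodgeType N 𝒳 (2 * p) p p ξ →
        (∀ i, IsAbsoluteHodgeClass (m i) (Y i) p
          (complexBetti.map (g i ≫ fiberι f o) (2 * p) ξ)) →
        ∀ (t : AlgPoints C ℂ) (n : ℕ),
          IsAbsoluteHodgeClass n (fiberOver f t) p (complexBetti.map (fiberι f t) (2 * p) ξ)

/-- **`ht` is load-bearing (for a typing reason): without it the crux is FALSE.** Witness, ALL of
whose hypotheses are discharged in the tree: the constant family of the point `pt × ℙ¹ ⟶ ℙ¹`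
(`exists_constFamily` at `X = 𝟙_`), `p = 1`, `ξ = pr₁^* 0`, one piece `Y = 𝟙_` glued onto the fibre
`X_t ≅ pt` by the slice isomorphism (it covers), absolute Hodge on the piece by
`isAbsoluteHodgeClass_unit` (`H²(pt) = 0`); the deleted clause then asserts
`IsAbsoluteHodgeClass 1 X_t 1 _`, whose Hodge-type conjunct needs a `HodgeModel 1 X_t` — a
one-dimensional complex manifold homeomorphic to the point `X_t(ℂ)`, impossible
(`false_of_hodgeModel_of_subsingleton`). Moral for the planner: in `ht` only "smooth" and "`n` is the
fibre dimension" are visibly used; projectivity of `X_t` is automatic (fibre of a projective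
morphism) and geometric irreducibility of `X_t` is possibly unnecessary. [cite: CharlesSchnell2014Notes, Def. 11.2.3] -/
theorem boundaryAbsoluteness_false_without_fibreHyp : ¬ BoundaryAbsolutenessWithoutFibreHyp := by
  intro h
  have hU : IsSmoothProjective 0 (𝟙_ (SchemeOver ℂ)) := isSmoothProjective_unit_holds ℂ
  obtain ⟨𝒳, C, f, t, ξ, e, h𝒳, hC, hf, hξr, hξh, -, hcov, -⟩ :=
    exists_constFamily hU 1 (0 : complexBetti (𝟙_ (SchemeOver ℂ)) (2 * 1))
  have key := h (0 + 1) 1 𝒳 C f t h𝒳 hC hf Unit (fun _ => 0) (fun _ => 𝟙_ (SchemeOver ℂ))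
    (fun _ => e.hom) (fun _ => hU) (fun x => ?_) ξ (hξr IsRationalClass.zero)
    (hξh (isOfHodgeType_zero_of_isSmoothProjective nonempty_hodgeModel_holds hU _ _ _))
    (fun _ => isAbsoluteHodgeClass_unit' le_rfl _) t 1
  · obtain ⟨A, -⟩ := key.2.1
    obtain ⟨hs, hne⟩ := subsingleton_complexPoints_of_iso_unit e
    exact false_of_hodgeModel_of_subsingleton le_rfl A
  · obtain ⟨y, hy⟩ := hcov x
    exact ⟨(), y, hy⟩

/-! ## (a) Load-bearing analysis, hypothesis `hf : Function.Surjective f.left.base` -/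

/-- The crux with the surjectivity hypothesis `hf` deleted (constant maps `f` allowed). -/
def BoundaryAbsolutenessWithoutSurjective : Prop :=
  ∀ (N p : ℕ) (𝒳 C : SchemeOver ℂ) (f : 𝒳 ⟶ C) (o : AlgPoints C ℂ),
    IsSmoothProjective N 𝒳 → IsSmoothProjective 1 C →
    ∀ (ι : Type) [Finite ι] (m : ι → ℕ) (Y : ι → SchemeOver ℂ) (g : ∀ i, Y i ⟶ fiberOver f o),
      (∀ i, IsSmoothProjective (m i) (Y i)) →
      (∀ x : ↥(fiberOver f o).left, ∃ (i : ι) (y : ↥(Y i).left), (g i).left.base y = x) →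
      ∀ ξ : complexBetti 𝒳 (2 * p), IsRationalClass ξ → IsOfHodgeType N 𝒳 (2 * p) p p ξ →
        (∀ i, IsAbsoluteHodgeClass (m i) (Y i) p
          (complexBetti.map (g i ≫ fiberι f o) (2 * p) ξ)) →
        ∀ (t : AlgPoints C ℂ) (n : ℕ), IsSmoothProjective n (fiberOver f t) →
          IsAbsoluteHodgeClass n (fiberOver f t) p (complexBetti.map (fiberι f t) (2 * p) ξ)

section ConstantMap

variable {X C : SchemeOver ℂ}

/-- The CONSTANT morphism `X ⟶ C` at a complex point `t ∈ C(ℂ)`: `X → Spec ℂ → C`. [folklore] -/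
def constAt (X : SchemeOver ℂ) (t : AlgPoints C ℂ) : X ⟶ C :=
  toUnit X ≫ (AffineLineProduct.specOverSelfIso ℂ).inv ≫ t

/-- The underlying point of a complex point is the image of ANY point of `Spec ℂ`. [folklore] -/
theorem pt_eq_base (t : AlgPoints C ℂ) (x : ↥(Spec (CommRingCat.of ℂ))) : t.pt = t.left.base x := by
  have hx : x = (IsLocalRing.closedPoint ℂ : ↥(Spec (CommRingCat.of ℂ))) := Subsingleton.elim _ _
  subst hx
  rfl

/-- A complex point of a `ℂ`-scheme is a monomorphism of schemes (it is a section of the structure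
morphism over `Spec ℂ`, which is an isomorphism `Spec ℂ ⟶ Spec ℂ`). [folklore] -/
theorem mono_left (t : AlgPoints C ℂ) : Mono t.left := by
  haveI : IsIso (CommRingCat.ofHom (algebraMap ℂ ℂ)) := by
    rw [Algebra.algebraMap_self, CommRingCat.ofHom_id]
    infer_instance
  haveI : Mono (specOver ℂ ℂ).hom :=
    show Mono (Spec.map (CommRingCat.ofHom (algebraMap ℂ ℂ))) from inferInstance
  exact mono_of_mono_fac (Over.w t)

/-- **The fibre of a constant map over its value is the source**: `X ≅ X_t` for `f = constAt X t`,
compatibly with the fibre inclusion (`t` is a monomorphism, so `X` with `(𝟙, X → Spec ℂ)` is the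
fibre product `X ×_C Spec ℂ`). [cite: Hartshorne1977, II.3 (fibre of a morphism)] -/
theorem exists_iso_fiberOver_constAt (X : SchemeOver ℂ) (t : AlgPoints C ℂ) :
    ∃ e : X ≅ fiberOver (constAt X t) t, e.hom ≫ fiberι (constAt X t) t = 𝟙 X := by
  haveI := mono_left t
  set s : X.left ⟶ (specOver ℂ ℂ).left := (toUnit X ≫ (AffineLineProduct.specOverSelfIso ℂ).inv).left
  have hfac : (constAt X t).left = s ≫ t.left := by
    simp only [constAt, s, Over.comp_left, Category.assoc]
  have hpb : IsPullback (𝟙 X.left) s (constAt X t).left t.left := by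
    refine IsPullback.of_isLimit' ⟨by rw [hfac, Category.id_comp]⟩ (PullbackCone.IsLimit.mk _
      (fun c => c.fst) (fun c => Category.comp_id _) (fun c => ?_) (fun c m h₁ _ => ?_))
    · apply (cancel_mono t.left).1
      rw [Category.assoc, ← hfac]
      exact c.condition
    · simpa using h₁
  refine ⟨Over.isoMk hpb.isoPullback ?_, ?_⟩
  · change hpb.isoPullback.hom ≫ pullback.fst _ _ ≫ X.hom = X.hom
    rw [← Category.assoc, hpb.isoPullback_hom_fst, Category.id_comp]
  · ext : 1
    change hpb.isoPullback.hom ≫ pullback.fst _ _ = 𝟙 X.left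
    exact hpb.isoPullback_hom_fst

/-- **The fibre of a constant map over any other point is empty.** [cite: Hartshorne1977, II.3] -/
theorem isEmpty_fiberOver_constAt (X : SchemeOver ℂ) {t o : AlgPoints C ℂ} (h : o.pt ≠ t.pt) :
    IsEmpty ↥(fiberOver (constAt X t) o).left := by
  refine ⟨fun z => h ?_⟩
  have hc := congrArg (fun k => k.base z) (pullback.condition (f := (constAt X t).left) (g := o.left))
  simp only [Scheme.Hom.comp_base, TopCat.comp_app] at hc
  -- `hc : (constAt X t).left.base (fst z) = o.left.base (snd z)`
  have h1 : (constAt X t).left.base (pullback.fst (constAt X t).left o.left |>.base z) =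
      t.left.base ((toUnit X ≫ (AffineLineProduct.specOverSelfIso ℂ).inv).left.base
        (pullback.fst (constAt X t).left o.left |>.base z)) := by
    simp only [constAt, Over.comp_left, Scheme.Hom.comp_base, TopCat.comp_app]
  rw [pt_eq_base o (pullback.snd (constAt X t).left o.left |>.base z), ← hc, h1, ← pt_eq_base t]

end ConstantMap

/-- **Without surjectivity of `f` the crux IS Conj. 11.2.17.** (→) the constant map
`f = constAt X t : X ⟶ ℙ¹` at `t` and a second point `o ≠ t` of `ℙ¹(ℂ)` (`ℙ¹(ℂ)` is infinite):
the fibre over `o` is EMPTY, so `ι = PEmpty` covers it and all piece hypotheses are vacuous, while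
the fibre over `t` is `X` itself; transport along `X ≅ X_t` (`stub_absoluteOfIso`). (←) as before.
So `hf` is load-bearing exactly to the extent that Conj. 11.2.17 is open.
[cite: CharlesSchnell2014Notes, §11.2.5 Conj. 11.2.17] -/
theorem withoutSurjective_iff_hodgeClassesAbsolute :
    BoundaryAbsolutenessWithoutSurjective ↔ HodgeClassesAbsolute := by
  constructor
  · intro h n X hX p c hc hpp
    have hC : IsSmoothProjective 1 (projectiveSpace 1 ℂ) := isSmoothProjective_projectiveSpace_holds ℂ 1
    haveI : Infinite (ComplexPoints (projectiveSpace 1 ℂ)) := HodgeBeyondAnchors.infinite_complexPoints_projectiveSpace_one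
    obtain ⟨t⟩ : Nonempty (ComplexPoints (projectiveSpace 1 ℂ)) := inferInstance
    obtain ⟨o, hot⟩ := exists_ne t
    have hpt : o.pt ≠ t.pt := fun h' => hot (ComplexPoints.ext_of_pt_eq h')
    obtain ⟨e, he⟩ := exists_iso_fiberOver_constAt X t
    haveI := isEmpty_fiberOver_constAt X hpt
    have ht : IsSmoothProjective n (fiberOver (constAt X t) t) := hX.of_iso e
    have key := h n p X (projectiveSpace 1 ℂ) (constAt X t) o hX hC PEmpty (fun i => i.elim)
      (fun i => i.elim) (fun i => i.elim) (fun i => i.elim) (fun x => isEmptyElim x) c hc hpp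
      (fun i => i.elim) t n ht
    have hback := stub_absoluteOfIso e ht hX p _ key
    rwa [← complexBetti_map_comp_apply, he, complexBetti.map_id] at hback
  · intro hHA N p 𝒳 C f o h𝒳 _ ι _ m Y g _ _ ξ hξr hξh _ t n ht
    exact hHA ht p _ (hξr.pullback (AlgPoints.mapContinuous (L := ℂ) (fiberι f t)))
      (hξh.map_of_isSmoothProjective ht h𝒳 (fiberι f t))


/-! ## (a′) `hξr` and `hξh` are NOT load-bearing: the line's stubs prove the crux for ANY complex class

The four still-OPEN statements of line `typewise_readout` (VERBATIM `Lines/typewise_readout.lean`;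
the other three stubs are landed tree theorems `stub_rationalDescent`, `stub_typeDescent`,
`stub_vanishingPropagation`) and, from them, the crux with BOTH hypotheses on the class deleted. -/

/-- Line statement 1 (open stub `stub_conjugate_exists`), verbatim. -/
def ConjugateExists : Prop :=
  ∀ ⦃n : ℕ⦄ ⦃X : SchemeOver ℂ⦄, IsSmoothProjective n X →
    ∀ (σ : ℂ ≃+* ℂ) (k : ℕ) (c : complexBetti X k), ∃ c', IsConjugateClass σ X k c c'

/-- Line statement 2 (stub `stub_conjugateNaturality`, closed modulo `chartConjugation_canonical`), verbatim. -/
def ConjugateNaturality : Prop :=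
  ∀ ⦃m n : ℕ⦄ ⦃Y X : SchemeOver ℂ⦄, IsSmoothProjective m Y → IsSmoothProjective n X →
    ∀ (g : Y ⟶ X) (σ : ℂ ≃+* ℂ) (k : ℕ) (c : complexBetti X k)
      (c' : complexBetti (conjugateVariety σ X) k) (d' : complexBetti (conjugateVariety σ Y) k),
      IsConjugateClass σ X k c c' → IsConjugateClass σ Y k (complexBetti.map g k c) d' →
        d' = complexBetti.map (conjHom σ g) k c'

/-- Line statement 5A (open stub `stub_conjugateFibre`), verbatim. -/
def ConjugateFibre : Prop :=
  (∀ ⦃𝒳 C : SchemeOver ℂ⦄ (f : 𝒳 ⟶ C) (σ : ℂ ≃+* ℂ) (t : AlgPoints C ℂ),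
      ∃ (t' : AlgPoints (conjugateVariety σ C) ℂ)
        (e : conjugateVariety σ (fiberOver f t) ≅ fiberOver (conjHom σ f) t'),
        e.hom ≫ fiberι (conjHom σ f) t' = conjHom σ (fiberι f t)) ∧
  (∀ ⦃X : SchemeOver ℂ⦄ ⦃ι : Type⦄ ⦃Y : ι → SchemeOver ℂ⦄ (g : ∀ i, Y i ⟶ X) (σ : ℂ ≃+* ℂ),
      (∀ x : ↥X.left, ∃ (i : ι) (y : ↥(Y i).left), (g i).left.base y = x) →
      ∀ x' : ↥(conjugateVariety σ X).left,
        ∃ (i : ι) (y' : ↥(conjugateVariety σ (Y i)).left), (conjHom σ (g i)).left.base y' = x')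

/-- Line statement 5B (open stub `stub_smoothFibreLocus`), verbatim. -/
def SmoothFibreLocus : Prop :=
  ∀ ⦃N : ℕ⦄ ⦃𝒳 C : SchemeOver ℂ⦄ (f : 𝒳 ⟶ C), IsSmoothProjective N 𝒳 → IsSmoothProjective 1 C →
    Function.Surjective f.left.base →
    ∃ (W : C.left.Opens) (d : ℕ), SmoothOfRelativeDimension d (f.left ∣_ W) ∧
      ∀ (t : AlgPoints C ℂ) ⦃n : ℕ⦄, IsSmoothProjective n (fiberOver f t) → t.pt ∈ W

/-- The fibre kernel inclusion on every conjugate family (line statement 5) from 5A, 5B and the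
LANDED 5C (`stub_vanishingPropagation`) — the lead's `fibreKernelInclusion_of`, re-run here with
the tree theorem in place of the stub. [cite: DeligneHodgeIII1974, Prop. 8.2.7] -/
theorem fibreKernelInclusion_of (hA : ConjugateFibre) (hB : SmoothFibreLocus) :
    ∀ ⦃N : ℕ⦄ ⦃𝒳 C : SchemeOver ℂ⦄ (f : 𝒳 ⟶ C) (o : AlgPoints C ℂ),
      IsSmoothProjective N 𝒳 → IsSmoothProjective 1 C → Function.Surjective f.left.base →
      ∀ ⦃ι : Type⦄ [Finite ι] ⦃m : ι → ℕ⦄ ⦃Y : ι → SchemeOver ℂ⦄ (g : ∀ i, Y i ⟶ fiberOver f o),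
        (∀ i, IsSmoothProjective (m i) (Y i)) →
        (∀ x : ↥(fiberOver f o).left, ∃ (i : ι) (y : ↥(Y i).left), (g i).left.base y = x) →
        ∀ (σ : ℂ ≃+* ℂ) (k : ℕ) (x : complexBetti (conjugateVariety σ 𝒳) k),
          (∀ i, complexBetti.map (conjHom σ (g i ≫ fiberι f o)) k x = 0) →
          ∀ (t : AlgPoints C ℂ) ⦃n : ℕ⦄, IsSmoothProjective n (fiberOver f t) →
            complexBetti.map (conjHom σ (fiberι f t)) k x = 0 := by
  intro N 𝒳 C f o h𝒳 hC₁ hf ι _ m Y g hY hcov σ k x hx t n ht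
  obtain ⟨o', eo, heo⟩ := hA.1 f σ o
  obtain ⟨t', et, het⟩ := hA.1 f σ t
  have h𝒳' : IsSmoothProjective N (conjugateVariety σ 𝒳) :=
    IsSmoothProjective.conjugateVariety_holds σ h𝒳
  have hC' : IsSmoothProjective 1 (conjugateVariety σ C) :=
    IsSmoothProjective.conjugateVariety_holds σ hC₁
  have hf' : Function.Surjective (conjHom σ f).left.base := by
    haveI : Surjective f.left := ⟨hf⟩
    have hs : Surjective (conjHom σ f).left :=
      MorphismProperty.of_isPullback (P := @Surjective)
        (Literature.AlgebraicGeometry.Motives.isPullback_baseChangeHom_map_left σ.toRingHom f)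
        ‹Surjective f.left›
    exact hs.surj
  let g' : ∀ i, conjugateVariety σ (Y i) ⟶ fiberOver (conjHom σ f) o' :=
    fun i => conjHom σ (g i) ≫ eo.hom
  have hY' : ∀ i, IsSmoothProjective (m i) (conjugateVariety σ (Y i)) := fun i =>
    IsSmoothProjective.conjugateVariety_holds σ (hY i)
  have hcov' : ∀ x' : ↥(fiberOver (conjHom σ f) o').left,
      ∃ (i : ι) (y : ↥(conjugateVariety σ (Y i)).left), (g' i).left.base y = x' := by
    intro x'
    obtain ⟨i, y', hy'⟩ := hA.2 g σ hcov (eo.inv.left.base x')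
    refine ⟨i, y', ?_⟩
    have hcomp : (g' i).left.base y' = eo.hom.left.base ((conjHom σ (g i)).left.base y') := by
      change (conjHom σ (g i) ≫ eo.hom).left.base y' = _
      simp only [Over.comp_left, Scheme.Hom.comp_base, TopCat.comp_app]
    have hid : eo.hom.left.base (eo.inv.left.base x') = x' := by
      have h1 : (eo.inv ≫ eo.hom).left.base x' = x' := by
        rw [eo.inv_hom_id]
        simp only [Over.id_left, Scheme.Hom.id_base, TopCat.id_app]
      simpa only [Over.comp_left, Scheme.Hom.comp_base, TopCat.comp_app] using h1
    rw [hcomp, hy', hid]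
  have hx' : ∀ i, complexBetti.map (g' i ≫ fiberι (conjHom σ f) o') k x = 0 := by
    intro i
    have hfun : g' i ≫ fiberι (conjHom σ f) o' = conjHom σ (g i ≫ fiberι f o) := by
      change (conjHom σ (g i) ≫ eo.hom) ≫ fiberι (conjHom σ f) o' = _
      rw [Category.assoc, heo]
      exact ((baseChangeHom σ.toRingHom).map_comp (g i) (fiberι f o)).symm
    rw [hfun]
    exact hx i
  obtain ⟨W, d, hW, hmem⟩ := hB (conjHom σ f) h𝒳' hC' hf'
  have ht' : IsSmoothProjective n (fiberOver (conjHom σ f) t') :=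
    IsSmoothProjective.of_iso et (IsSmoothProjective.conjugateVariety_holds σ ht)
  have key : complexBetti.map (fiberι (conjHom σ f) t') k x = 0 :=
    stub_vanishingPropagation (conjHom σ f) o' h𝒳' hC' hf' g' hY' hcov' W d hW k x hx' t' (hmem t' ht')
  rw [← het, complexBetti.map_comp, ModuleCat.comp_apply, key, map_zero]

/-- The crux with BOTH hypotheses on the class deleted (`ξ` any complex class of degree `2p`):
absoluteness on the pieces ⟹ absoluteness on every smooth projective fibre. -/
def BoundaryAbsolutenessWithoutRationalType : Prop :=
  ∀ (N p : ℕ) (𝒳 C : SchemeOver ℂ) (f : 𝒳 ⟶ C) (o : AlgPoints C ℂ),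
    IsSmoothProjective N 𝒳 → IsSmoothProjective 1 C → Function.Surjective f.left.base →
    ∀ (ι : Type) [Finite ι] (m : ι → ℕ) (Y : ι → SchemeOver ℂ) (g : ∀ i, Y i ⟶ fiberOver f o),
      (∀ i, IsSmoothProjective (m i) (Y i)) →
      (∀ x : ↥(fiberOver f o).left, ∃ (i : ι) (y : ↥(Y i).left), (g i).left.base y = x) →
      ∀ ξ : complexBetti 𝒳 (2 * p),
        (∀ i, IsAbsoluteHodgeClass (m i) (Y i) p
          (complexBetti.map (g i ≫ fiberι f o) (2 * p) ξ)) →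
        ∀ (t : AlgPoints C ℂ) (n : ℕ), IsSmoothProjective n (fiberOver f t) →
          IsAbsoluteHodgeClass n (fiberOver f t) p (complexBetti.map (fiberι f t) (2 * p) ξ)

/-- **`hξr`, `hξh` are NOT load-bearing.** The four OPEN stubs of the line (statements 1, 2, 5A, 5B)
together with the three LANDED ones prove the crux for an ARBITRARY complex class `ξ`: rationality
and the type `(p,p)` of `ξ|_{X_t}` themselves descend from the pieces (`stub_rationalDescent`,
`stub_typeDescent`) along the σ-FREE kernel inclusion on `𝒳` (`stub_vanishingPropagation` over the
smooth-fibre locus of 5B); the conjugation clause is the lead's `kernelDescent_of` verbatim. So any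
proof along this line proves the stronger engine, and the planner may state it for complex `ξ`.
[cite: CharlesSchnell2014Notes, Def. 11.2.3] [cite: DeligneHodgeIII1974, Prop. 8.2.7] -/
theorem withoutRationalType_of_openStubs (h₁ : ConjugateExists) (h₂ : ConjugateNaturality)
    (h₅ : ConjugateFibre) (h₆ : SmoothFibreLocus) : BoundaryAbsolutenessWithoutRationalType := by
  intro N p 𝒳 C f o h𝒳 hC hf ι _ m Y g hY hcov ξ habs t n ht
  -- the σ-free kernel inclusion on `𝒳` itself
  obtain ⟨W, d, hW, hmem⟩ := h₆ f h𝒳 hC hf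
  have hker0 : ∀ x : complexBetti 𝒳 (2 * p),
      (∀ i, complexBetti.map (g i ≫ fiberι f o) (2 * p) x = 0) →
        complexBetti.map (fiberι f t) (2 * p) x = 0 := fun x hx =>
    stub_vanishingPropagation f o h𝒳 hC hf g hY hcov W d hW (2 * p) x hx t (hmem t ht)
  have hr : IsRationalClass (complexBetti.map (fiberι f t) (2 * p) ξ) :=
    stub_rationalDescent h𝒳 (fun i => g i ≫ fiberι f o) hY (fiberι f t) ht (2 * p) hker0 ξ
      (fun i => (habs i).1)
  have hpp : IsOfHodgeType n (fiberOver f t) (2 * p) p p (complexBetti.map (fiberι f t) (2 * p) ξ) :=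
    stub_typeDescent h𝒳 (fun i => g i ≫ fiberι f o) hY (fiberι f t) ht (2 * p) p p hker0 ξ
      (fun i => (habs i).2.1)
  -- the kernel inclusion on every conjugate family
  have hker : ∀ (σ : ℂ ≃+* ℂ) (k : ℕ) (x : complexBetti (conjugateVariety σ 𝒳) k),
      (∀ i, complexBetti.map (conjHom σ (g i ≫ fiberι f o)) k x = 0) →
        complexBetti.map (conjHom σ (fiberι f t)) k x = 0 := fun σ k x hx =>
    fibreKernelInclusion_of h₅ h₆ f o h𝒳 hC hf g hY hcov σ k x hx t ht
  refine ⟨hr, hpp, fun σ => ⟨h₁ ht σ (2 * p) _, fun c' hc' => ?_⟩⟩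
  obtain ⟨Ξ', hΞ'⟩ := h₁ h𝒳 σ (2 * p) ξ
  have hc'eq : c' = complexBetti.map (conjHom σ (fiberι f t)) (2 * p) Ξ' :=
    h₂ ht h𝒳 (fiberι f t) σ (2 * p) ξ Ξ' c' hΞ' hc'
  obtain ⟨Θ, hΘ⟩ : ∃ Θ : complexBetti (conjugateVariety σ 𝒳) (2 * p), Θ = (periodTwist σ p)⁻¹ • Ξ' :=
    ⟨_, rfl⟩
  have htw : periodTwist σ p ≠ 0 := periodTwist_ne_zero σ p
  have hΘY : ∀ i, IsRationalClass (complexBetti.map (conjHom σ (g i ≫ fiberι f o)) (2 * p) Θ) ∧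
      IsOfHodgeType (m i) (conjugateVariety σ (Y i)) (2 * p) p p
        (complexBetti.map (conjHom σ (g i ≫ fiberι f o)) (2 * p) Θ) := by
    intro i
    obtain ⟨d₀, hd⟩ := ((habs i).2.2 σ).1
    obtain ⟨βi, hβi, hβiH, hdβ⟩ := ((habs i).2.2 σ).2 d₀ hd
    have hdΞ : d₀ = complexBetti.map (conjHom σ (g i ≫ fiberι f o)) (2 * p) Ξ' :=
      h₂ (hY i) h𝒳 (g i ≫ fiberι f o) σ (2 * p) ξ Ξ' d₀ hΞ' hd
    have hΘi : complexBetti.map (conjHom σ (g i ≫ fiberι f o)) (2 * p) Θ = βi := by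
      rw [hΘ, map_smul, ← hdΞ, hdβ, smul_smul, inv_mul_cancel₀ htw, one_smul]
    rw [hΘi]
    exact ⟨hβi, hβiH⟩
  have h𝒳' : IsSmoothProjective N (conjugateVariety σ 𝒳) := IsSmoothProjective.conjugateVariety_holds σ h𝒳
  have hY' : ∀ i, IsSmoothProjective (m i) (conjugateVariety σ (Y i)) := fun i =>
    IsSmoothProjective.conjugateVariety_holds σ (hY i)
  have ht'' : IsSmoothProjective n (conjugateVariety σ (fiberOver f t)) :=
    IsSmoothProjective.conjugateVariety_holds σ ht
  have hβ : IsRationalClass (complexBetti.map (conjHom σ (fiberι f t)) (2 * p) Θ) :=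
    stub_rationalDescent h𝒳' (fun i => conjHom σ (g i ≫ fiberι f o)) hY' (conjHom σ (fiberι f t))
      ht'' (2 * p) (hker σ (2 * p)) Θ (fun i => (hΘY i).1)
  have hβH : IsOfHodgeType n (conjugateVariety σ (fiberOver f t)) (2 * p) p p
      (complexBetti.map (conjHom σ (fiberι f t)) (2 * p) Θ) :=
    stub_typeDescent h𝒳' (fun i => conjHom σ (g i ≫ fiberι f o)) hY' (conjHom σ (fiberι f t))
      ht'' (2 * p) p p (hker σ (2 * p)) Θ (fun i => (hΘY i).2)
  have hc'β : c' = periodTwist σ p • complexBetti.map (conjHom σ (fiberι f t)) (2 * p) Θ := by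
    rw [hc'eq, hΘ, map_smul, smul_smul, mul_inv_cancel₀ htw, one_smul]
  exact ⟨_, hβ, hβH, hc'β⟩

/-- …and of course the crux itself is the special case (so, modulo the four open stubs, the crux). -/
theorem boundaryAbsoluteness_of_withoutRationalType (h : BoundaryAbsolutenessWithoutRationalType) :
    BoundaryAbsoluteness :=
  fun N p 𝒳 C f o h𝒳 hC hf ι _ m Y g hY hcov ξ _ _ habs t n ht =>
    h N p 𝒳 C f o h𝒳 hC hf ι m Y g hY hcov ξ habs t n ht

end Summit.HodgeConjecture.HodgeConjecture.Cruxes.BoundaryAbsoluteness.Disproof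

end
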